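import Summits.BirchSwinnertonDyer.BirchSwinnertonDyer.Theorems.ClassRecordThreeEulerHalvesAtThreeCartanTransportCoverReduction
import Summits.BirchSwinnertonDyer.BirchSwinnertonDyer.Theorems.ClassRecordThreeEulerHalvesAtThreeCartanCoverAssembly
import HarnessLib

/-!
# Cartan transport, brick R′ — the cite-input (A) `CoverReductionExists` of the `Lines/lattice` v2 assembly is a THEOREM

Helper file for the crux `EulerHalvesAtThree` of route `ClassRecordThree` (node served: residue crux `EulerHalvesAtThreeResidualUpperBound`,
line `cartan`, item NUM := `CartanOnePlaceDegreeLawAtThree`, skeleton `Lines/lattice`). The LEAD's assembly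
`CartanCover.saturatedDictionary_of_coverFacts : CoverReductionExists → PeriodLatticeCharacter → SplitSideSheetAtThree →
DescentNonsplitAtThree → SaturationAtThree → (F2b♮)` (`…CartanCoverAssembly`, p729844) takes as first input the named `Prop`
`CartanCover.CoverReductionExists` («for `q ∈ C` the cover order `O₀'` has a reduction datum mod `q`»). Brick R
(`CartanTransport.Cover.nonempty_coverReduction`, p730002) proves exactly its body, so:
* `coverReductionExists : CartanCover.CoverReductionExists` (PROVED);
* `saturatedDictionary_of_coverFacts'` — the LEAD's assembly with input (A) discharged: FOUR inputs remain
  (`PeriodLatticeCharacter`, `SplitSideSheetAtThree` — print ∕ transport; `DescentNonsplitAtThree`, `SaturationAtThree` — the crux).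
Nothing is proved about NUM, (F2b♮), the four remaining inputs, or any summit statement. [cite: Voight2021, Lemma 23.2.3, Def. 23.4.1]
-/

set_option linter.dupNamespace false
set_option autoImplicit false

namespace Summit.BirchSwinnertonDyer.BirchSwinnertonDyer.Theorems.CartanTransport.Cover

open Summit.BirchSwinnertonDyer.BirchSwinnertonDyer.Theorems.CartanCover

/-- PROVED — **(A) `CoverReductionExists`**: for every Cartan datum `X : CartanLevelCurveData D M C` and every `q ∈ C` the cover order
`O₀' = X.O + n_q X.O₀` has a reduction datum modulo `q` (brick R, `nonempty_coverReduction`: residue model of the hull restricted to `O₀'`,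
pinning field `𝔽_q[η_q]`). [cite: Voight2021, Lemma 23.2.3, Def. 23.4.1] -/
theorem coverReductionExists : CoverReductionExists := fun _ _ _ X _ _ hq => nonempty_coverReduction X hq

/-- PROVED — **the `Lines/lattice` v2 assembly with (A) discharged**: the saturated Hom-lattice dictionary (F2b♮) follows from the FOUR
remaining inputs (M) `PeriodLatticeCharacter`, (P+T) `SplitSideSheetAtThree`, (D3) `DescentNonsplitAtThree`, (D4) `SaturationAtThree`
(tree `CartanCover.saturatedDictionary_of_coverFacts` with `coverReductionExists`). [cite: Voight2021, Lemma 23.2.3] -/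
theorem saturatedDictionary_of_coverFacts' (hM : PeriodLatticeCharacter) (hPT : SplitSideSheetAtThree)
    (hD3 : DescentNonsplitAtThree) (hD4 : SaturationAtThree) :
    CartanSaturatedDictionary.CartanHomLatticeSaturatedDictionaryAtThree :=
  saturatedDictionary_of_coverFacts coverReductionExists hM hPT hD3 hD4

end Summit.BirchSwinnertonDyer.BirchSwinnertonDyer.Theorems.CartanTransport.Cover
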